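import Mathlib
import Literature.Analysis.PDE.SingleEntropy.OleinikEntropySmooth
import HarnessLib

/-!
# Oleĭnik's one-sided bound implies the entropy inequalities, II: the limit

Topic `Literature/Analysis/PDE/SingleEntropy`. `entropy_of_oneSided_C2`: let `f ∈ C²` be convex,
`u ∈ L^∞` a distributional solution of `uₜ + f(u)ₓ = 0` on an open `Ω ⊆ ℝ²` which near every
point of `Ω` satisfies a one-sided bound `uₓ ≤ C` in `𝒟'`; then `η(u)ₜ + q(u)ₓ ≤ 0` in `𝒟'(Ω)`
for every `C²` convex entropy `η` with flux `q' = f' η'` (stated in the test-function format of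
`Literature.Analysis.PDE.deLellisOttoWestdickenberg_singleEntropy`). Proof: uniformise the local
bounds on `tsupport φ` (finite subcover + Lebesgue number, `uniform_oneSided`), mollify, apply
`entropy_pairing_ge_smooth`, and pass to the limit by dominated convergence using a.e.
convergence of mollifications. Classical: Oleĭnik 1957; Dafermos §11.2; Hörmander 1997 §2.4.
[folklore]
-/

noncomputable section

open MeasureTheory Set Filter Metric ContinuousLinearMap
open scoped Topology Convolution

namespace Literature.Analysis.PDE.SingleEntropy


/-- A continuous function is bounded on `[-M, M]`. [folklore] -/
theorem exists_abs_le_on_Icc {g : ℝ → ℝ} (hg : Continuous g) (M : ℝ) :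
    ∃ A, 0 ≤ A ∧ ∀ w, |w| ≤ M → |g w| ≤ A := by
  obtain ⟨C, hC⟩ := (isCompact_Icc (a := -M) (b := M)).exists_bound_of_continuousOn
    hg.continuousOn
  refine ⟨max C 0, le_max_right _ _, fun w hw => ?_⟩
  have := hC w (mem_Icc.mpr (abs_le.mp hw))
  rw [Real.norm_eq_abs] at this
  exact this.trans (le_max_left _ _)

/-- **Uniform local one-sided bound on a compact set.** From pointwise-local bounds `uₓ ≤ C(p)`
near each point of `Ω`, extract one radius `δ` and one constant `C ≥ 0` serving every point of a
compact `K ⊆ Ω`, with `closedBall x δ ⊆ Ω` for `x ∈ K`. (Finite subcover + Lebesgue number.) [folklore] -/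
theorem uniform_oneSided {Ω : Set (ℝ × ℝ)} (hΩ : IsOpen Ω) {u : ℝ × ℝ → ℝ} {K : Set (ℝ × ℝ)}
    (hK : IsCompact K) (hKΩ : K ⊆ Ω)
    (hol : ∀ p ∈ Ω, ∃ C r : ℝ, 0 < r ∧ ∀ ψ : ℝ × ℝ → ℝ, ContDiff ℝ (⊤ : ℕ∞) ψ →
      HasCompactSupport ψ → tsupport ψ ⊆ ball p r → (∀ z, 0 ≤ ψ z) →
        -(C * ∫ z, ψ z) ≤ ∫ z, u z * fderiv ℝ ψ z (0, 1)) :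
    ∃ δ C : ℝ, 0 < δ ∧ 0 ≤ C ∧ ∀ x ∈ K, closedBall x δ ⊆ Ω ∧
      ∀ ψ : ℝ × ℝ → ℝ, ContDiff ℝ (⊤ : ℕ∞) ψ → HasCompactSupport ψ →
        tsupport ψ ⊆ ball x δ → (∀ z, 0 ≤ ψ z) →
          -(C * ∫ z, ψ z) ≤ ∫ z, u z * fderiv ℝ ψ z (0, 1) := by
  obtain ⟨δ₁, hδ₁, hthick⟩ := hK.exists_cthickening_subset_open hΩ hKΩ
  choose! C r hr hC using hol
  obtain ⟨t, ht⟩ := hK.elim_finite_subcover (fun p : Ω => ball (p : ℝ × ℝ) (r p))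
    (fun _ => isOpen_ball)
    (fun x hx => mem_iUnion.2 ⟨⟨x, hKΩ hx⟩, mem_ball_self (hr x (hKΩ hx))⟩)
  have hcov : K ⊆ ⋃ i : t, ball ((i : Ω) : ℝ × ℝ) (r i) := by
    intro x hx
    have := ht hx
    simp only [mem_iUnion] at this
    obtain ⟨i, hi, hxi⟩ := this
    exact mem_iUnion.2 ⟨⟨i, hi⟩, hxi⟩
  obtain ⟨δ₂, hδ₂, hleb⟩ := lebesgue_number_lemma_of_metric hK (fun _ => isOpen_ball) hcov
  refine ⟨min δ₁ δ₂, ∑ i ∈ t, |C i|, lt_min hδ₁ hδ₂,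
    Finset.sum_nonneg (fun i _ => abs_nonneg _), fun x hx => ⟨?_, ?_⟩⟩
  · exact ((closedBall_subset_closedBall (min_le_left _ _)).trans
      (closedBall_subset_cthickening hx δ₁)).trans hthick
  · intro ψ hψ hψc hψs hψ0
    obtain ⟨i, hi⟩ := hleb x hx
    have hsub : tsupport ψ ⊆ ball ((i : Ω) : ℝ × ℝ) (r i) :=
      (hψs.trans (ball_subset_ball (min_le_right _ _))).trans hi
    have h1 := hC i (i : Ω).2 ψ hψ hψc hsub hψ0
    have hint : 0 ≤ ∫ z, ψ z := integral_nonneg hψ0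
    have hCi : C i ≤ ∑ j ∈ t, |C j| :=
      (le_abs_self _).trans
        (Finset.single_le_sum (f := fun j : Ω => |C (j : ℝ × ℝ)|) (fun j _ => abs_nonneg _) i.2)
    nlinarith

/-- **One-sided Lipschitz bound ⇒ all `C²` convex entropy inequalities.** Let `f ∈ C²` be
convex and let `u ∈ L^∞` solve `uₜ + f(u)ₓ = 0` in `𝒟'(Ω)` and satisfy, locally near every point
of `Ω`, a one-sided bound `uₓ ≤ C` in `𝒟'`. Then `η(u)ₜ + q(u)ₓ ≤ 0` in `𝒟'(Ω)` for every `C²`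
convex entropy `η` with flux `q' = f' η'`. Proof: mollify, `entropy_pairing_ge_smooth`, and pass to
the limit by dominated convergence (Lebesgue points). This is the classical fact that Oleĭnik's
condition E implies the entropy condition (e.g. Dafermos, *Hyperbolic Conservation Laws*, §11.2;
Hörmander 1997, §2.4). [folklore] -/
theorem entropy_of_oneSided_C2 {f η q : ℝ → ℝ} (hf : ContDiff ℝ 2 f)
    (hfc : ∀ w, 0 ≤ deriv (deriv f) w) (hη : ContDiff ℝ 2 η) (hηc : ∀ w, 0 ≤ deriv (deriv η) w)
    (hq : ∀ w, HasDerivAt q (deriv f w * deriv η w) w)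
    {Ω : Set (ℝ × ℝ)} (hΩ : IsOpen Ω) {u : ℝ × ℝ → ℝ} (hu : Measurable u) {M : ℝ}
    (huM : ∀ p, |u p| ≤ M)
    (hws : ∀ φ : ℝ × ℝ → ℝ, ContDiff ℝ (⊤ : ℕ∞) φ → HasCompactSupport φ → tsupport φ ⊆ Ω →
      ∫ p in Ω, (u p * deriv (fun t => φ (t, p.2)) p.1
        + f (u p) * deriv (fun x => φ (p.1, x)) p.2) = 0)
    (hol : ∀ p ∈ Ω, ∃ C r : ℝ, 0 < r ∧ ∀ ψ : ℝ × ℝ → ℝ, ContDiff ℝ (⊤ : ℕ∞) ψ →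
      HasCompactSupport ψ → tsupport ψ ⊆ ball p r → (∀ z, 0 ≤ ψ z) →
        -(C * ∫ z, ψ z) ≤ ∫ z, u z * fderiv ℝ ψ z (0, 1))
    {φ : ℝ × ℝ → ℝ} (hφ : ContDiff ℝ (⊤ : ℕ∞) φ) (hφc : HasCompactSupport φ)
    (hφΩ : tsupport φ ⊆ Ω) (hφ0 : ∀ p, 0 ≤ φ p) :
    0 ≤ ∫ p in Ω, (η (u p) * deriv (fun t => φ (t, p.2)) p.1
      + q (u p) * deriv (fun x => φ (p.1, x)) p.2) := by
  have hφ1 : Differentiable ℝ φ := hφ.differentiable (by simp)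
  have hφC1 : ContDiff ℝ 1 φ := hφ.of_le (by simp)
  rw [setIntegral_pairing_eq_integral hφΩ, integral_pairing_eq_fderiv hφ1]
  -- uniform local data on K = tsupport φ
  obtain ⟨δ, C, hδ, hC, hK⟩ := uniform_oneSided hΩ hφc hφΩ hol
  -- the mollifier sequence
  have hrpos : ∀ n : ℕ, 0 < δ / ((n : ℝ) + 2) := fun n => by positivity
  let ρs : ℕ → ContDiffBump (0 : ℝ × ℝ) := fun n =>
    ⟨δ / (2 * ((n : ℝ) + 2)), δ / ((n : ℝ) + 2), by positivity, by
      rw [div_lt_div_iff_of_pos_left hδ (by positivity) (by positivity)]; linarith⟩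
  have hrOut : ∀ n, (ρs n).rOut = δ / ((n : ℝ) + 2) := fun n => rfl
  have hrIn : ∀ n, (ρs n).rIn = δ / (2 * ((n : ℝ) + 2)) := fun n => rfl
  have hr_lt : ∀ n, (ρs n).rOut < δ := fun n => by
    rw [hrOut, div_lt_iff₀ (by positivity)]; nlinarith
  have hr_tend : Tendsto (fun n => (ρs n).rOut) atTop (𝓝 0) := by
    have h1 : Tendsto (fun n : ℕ => δ / ((n : ℝ) + 2)) atTop (𝓝 0) := by
      have := (tendsto_const_div_atTop_nhds_zero_nat δ).comp (tendsto_add_atTop_nat 2)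
      refine this.congr (fun n => ?_)
      simp [Function.comp]
    exact h1
  have hr2 : ∀ n, (ρs n).rOut ≤ 2 * (ρs n).rIn := fun n => by
    rw [hrOut, hrIn]; apply le_of_eq; field_simp
  -- bounds for the nonlinear functions on `[-M, M]`
  obtain ⟨Mf, hMf⟩ := exists_abs_comp_le huM hf.continuous
  have hfu : Measurable fun z => f (u z) := hf.continuous.measurable.comp hu
  have hη' : ContDiff ℝ 1 (deriv η) := hη.iterate_deriv' 1 1
  obtain ⟨Aη, hAη0, hAη⟩ := exists_abs_le_on_Icc hη.continuous M
  obtain ⟨Aq, hAq0, hAq⟩ := exists_abs_le_on_Icc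
    (continuous_iff_continuousAt.2 fun w => (hq w).continuousAt) M
  obtain ⟨Aη', hAη'0, hAη'⟩ := exists_abs_le_on_Icc hη'.continuous M
  obtain ⟨Aη'', hAη''0, hAη''⟩ := exists_abs_le_on_Icc (hη'.continuous_deriv le_rfl) M
  obtain ⟨Af, hAf0, hAf⟩ := exists_abs_le_on_Icc hf.continuous M
  -- the mollified functions
  set U : ℕ → ℝ × ℝ → ℝ := fun n => (ρs n).normed volume ⋆[lsmul ℝ ℝ, volume] u with hUdef
  set F : ℕ → ℝ × ℝ → ℝ :=
    fun n => (ρs n).normed volume ⋆[lsmul ℝ ℝ, volume] (fun z => f (u z)) with hFdef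
  have hUs : ∀ n, ContDiff ℝ (⊤ : ℕ∞) (U n) := fun n => contDiff_mollify (ρs n) hu huM
  have hFs : ∀ n, ContDiff ℝ (⊤ : ℕ∞) (F n) := fun n => contDiff_mollify (ρs n) hfu hMf
  have hUb : ∀ n p, |U n p| ≤ M := fun n p => abs_mollify_le (ρs n) huM p
  have hFb : ∀ n p, |F n p| ≤ Mf := fun n p => abs_mollify_le (ρs n) hMf p
  have heq : ∀ n, ∀ p ∈ tsupport φ, fderiv ℝ (U n) p (1, 0) + fderiv ℝ (F n) p (0, 1) = 0 :=
    fun n p hp => mollify_conservationLaw (ρs n) hu huM hf.continuous hws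
      (((closedBall_subset_closedBall (hr_lt n).le)).trans (hK p hp).1)
  have holn : ∀ n, ∀ p ∈ tsupport φ, fderiv ℝ (U n) p (0, 1) ≤ C :=
    fun n p hp => fderiv_mollify_le_of_oneSided (ρs n) hu huM (hK p hp).2
      (closedBall_subset_ball (hr_lt n))
  have hJ : ∀ n p, f (U n p) ≤ F n p := fun n p => comp_mollify_le (ρs n) hf hfc hu huM p
  have step : ∀ n, -(∫ p, (F n p - f (U n p))
      * (C * deriv (deriv η) (U n p) * φ p + deriv η (U n p) * fderiv ℝ φ p (0, 1)))
      ≤ ∫ p, (η (U n p) * fderiv ℝ φ p (1, 0) + q (U n p) * fderiv ℝ φ p (0, 1)) :=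
    fun n => entropy_pairing_ge_smooth hf hη hηc hq ((hUs n).of_le (by norm_cast))
      ((hFs n).of_le (by norm_cast)) hφ hφc hφ0 (heq n) (holn n) (hJ n)
  -- a.e. convergence
  have hUae : ∀ᵐ p ∂(volume : Measure (ℝ × ℝ)), Tendsto (fun n => U n p) atTop (𝓝 (u p)) :=
    ae_tendsto_mollify hr_tend hr2 hu huM
  have hFae : ∀ᵐ p ∂(volume : Measure (ℝ × ℝ)),
      Tendsto (fun n => F n p) atTop (𝓝 (f (u p))) :=
    ae_tendsto_mollify hr_tend hr2 hfu hMf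
  -- continuity / support bookkeeping
  have cφt : Continuous fun p => fderiv ℝ φ p (1, 0) :=
    (hφC1.continuous_fderiv one_ne_zero).clm_apply continuous_const
  have cφx : Continuous fun p => fderiv ℝ φ p (0, 1) :=
    (hφC1.continuous_fderiv one_ne_zero).clm_apply continuous_const
  have hz3 : ∀ p ∉ tsupport φ, φ p = 0 ∧ fderiv ℝ φ p (1, 0) = 0 ∧ fderiv ℝ φ p (0, 1) = 0 :=
    fun p hp => ⟨image_eq_zero_of_notMem_tsupport hp,
      by simp [fderiv_of_notMem_tsupport ℝ hp], by simp [fderiv_of_notMem_tsupport ℝ hp]⟩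
  have hqc : Continuous q := continuous_iff_continuousAt.2 fun w => (hq w).continuousAt
  -- dominated convergence for the entropy pairing
  have limI : Tendsto (fun n => ∫ p, (η (U n p) * fderiv ℝ φ p (1, 0)
      + q (U n p) * fderiv ℝ φ p (0, 1))) atTop
      (𝓝 (∫ p, (η (u p) * fderiv ℝ φ p (1, 0) + q (u p) * fderiv ℝ φ p (0, 1)))) := by
    refine tendsto_integral_of_dominated_convergence
      (fun p => Aη * ‖fderiv ℝ φ p (1, 0)‖ + Aq * ‖fderiv ℝ φ p (0, 1)‖) ?_ ?_ ?_ ?_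
    · intro n
      exact (((hη.continuous.comp (hUs n).continuous).mul cφt).add
        ((hqc.comp (hUs n).continuous).mul cφx)).aestronglyMeasurable
    · apply Continuous.integrable_of_hasCompactSupport (by fun_prop)
      exact HasCompactSupport.of_support_subset_isCompact hφc (fun p hp => by
        by_contra h
        exact hp (by simp [(hz3 p h).2.1, (hz3 p h).2.2]))
    · intro n
      refine ae_of_all _ fun p => ?_
      have h1 : ‖η (U n p)‖ ≤ Aη := by rw [Real.norm_eq_abs]; exact hAη _ (hUb n p)
      have h2 : ‖q (U n p)‖ ≤ Aq := by rw [Real.norm_eq_abs]; exact hAq _ (hUb n p)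
      calc ‖η (U n p) * fderiv ℝ φ p (1, 0) + q (U n p) * fderiv ℝ φ p (0, 1)‖
          ≤ ‖η (U n p) * fderiv ℝ φ p (1, 0)‖ + ‖q (U n p) * fderiv ℝ φ p (0, 1)‖ :=
            norm_add_le _ _
        _ = ‖η (U n p)‖ * ‖fderiv ℝ φ p (1, 0)‖ + ‖q (U n p)‖ * ‖fderiv ℝ φ p (0, 1)‖ := by
            rw [norm_mul, norm_mul]
        _ ≤ Aη * ‖fderiv ℝ φ p (1, 0)‖ + Aq * ‖fderiv ℝ φ p (0, 1)‖ := by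
            gcongr
    · filter_upwards [hUae] with p hp
      exact (((hη.continuous.tendsto _).comp hp).mul tendsto_const_nhds).add
        (((hqc.tendsto _).comp hp).mul tendsto_const_nhds)
  -- dominated convergence for the error term
  have limE : Tendsto (fun n => ∫ p, (F n p - f (U n p))
      * (C * deriv (deriv η) (U n p) * φ p + deriv η (U n p) * fderiv ℝ φ p (0, 1))) atTop
      (𝓝 (∫ p : ℝ × ℝ, (0 : ℝ))) := by
    refine tendsto_integral_of_dominated_convergence
      (fun p => (Mf + Af) * (C * Aη'' * ‖φ p‖ + Aη' * ‖fderiv ℝ φ p (0, 1)‖)) ?_ ?_ ?_ ?_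
    · intro n
      exact (((hFs n).continuous.sub (hf.continuous.comp (hUs n).continuous)).mul
        (((continuous_const.mul ((hη'.continuous_deriv le_rfl).comp (hUs n).continuous)).mul
          hφ.continuous).add ((hη'.continuous.comp (hUs n).continuous).mul cφx)))
        |>.aestronglyMeasurable
    · apply Continuous.integrable_of_hasCompactSupport (by fun_prop)
      exact HasCompactSupport.of_support_subset_isCompact hφc (fun p hp => by
        by_contra h
        exact hp (by simp [(hz3 p h).1, (hz3 p h).2.2]))
    · intro n
      refine ae_of_all _ fun p => ?_
      have h1 : ‖F n p - f (U n p)‖ ≤ Mf + Af := by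
        refine (norm_sub_le _ _).trans (add_le_add ?_ ?_)
        · rw [Real.norm_eq_abs]; exact hFb n p
        · rw [Real.norm_eq_abs]; exact hAf _ (hUb n p)
      have h2 : ‖deriv (deriv η) (U n p)‖ ≤ Aη'' := by
        rw [Real.norm_eq_abs]; exact hAη'' _ (hUb n p)
      have h3 : ‖deriv η (U n p)‖ ≤ Aη' := by rw [Real.norm_eq_abs]; exact hAη' _ (hUb n p)
      have h4 : ‖C * deriv (deriv η) (U n p) * φ p + deriv η (U n p) * fderiv ℝ φ p (0, 1)‖
          ≤ C * Aη'' * ‖φ p‖ + Aη' * ‖fderiv ℝ φ p (0, 1)‖ := by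
        refine (norm_add_le _ _).trans (add_le_add ?_ ?_)
        · rw [norm_mul, norm_mul, Real.norm_of_nonneg hC]
          gcongr
        · rw [norm_mul]
          gcongr
      rw [norm_mul]
      exact mul_le_mul h1 h4 (norm_nonneg _) ((norm_nonneg _).trans h1)
    · filter_upwards [hUae, hFae] with p hpU hpF
      have hlim1 : Tendsto (fun n => F n p - f (U n p)) atTop (𝓝 (f (u p) - f (u p))) :=
        hpF.sub ((hf.continuous.tendsto _).comp hpU)
      have hlim2 : Tendsto (fun n => C * deriv (deriv η) (U n p) * φ p
          + deriv η (U n p) * fderiv ℝ φ p (0, 1)) atTop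
          (𝓝 (C * deriv (deriv η) (u p) * φ p + deriv η (u p) * fderiv ℝ φ p (0, 1))) :=
        (((tendsto_const_nhds.mul (((hη'.continuous_deriv le_rfl).tendsto _).comp hpU)).mul
          tendsto_const_nhds)).add (((hη'.continuous.tendsto _).comp hpU).mul tendsto_const_nhds)
      simpa using hlim1.mul hlim2
  rw [integral_zero] at limE
  have lim2 := limI.add limE
  rw [add_zero] at lim2
  exact ge_of_tendsto' lim2 (fun n => by linarith [step n])

end Literature.Analysis.PDE.SingleEntropy
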